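import Literature.Geometry.Lorentzian.CauchyDevelopmentOneJet
import Literature.Geometry.Lorentzian.IsometryProofs
import Literature.Geometry.Lorentzian.LocalIsometryJetRigidity
import Mathlib.Geometry.Manifold.ContMDiffMFDeriv
import Mathlib.Analysis.SpecialFunctions.Sqrt
import HarnessLib

/-!
# The future unit normal of a data embedding is smooth along the data hypersurface

For a data embedding `𝒮 = (M, g, τ, ι, ν)` of an initial data set `D` on `X`
(`Literature.Geometry.Lorentzian.DataEmbedding`: `ι : X → M` a smooth embedding with spacelike
induced metric `ι^* g = h`, `ν` the future unit normal along `ι`) the normal field `ν` is a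
**pointwise** datum of the structure, characterised uniquely by `g(ν, dι v) = 0`,
`g(ν, ν) = -1`, `ν` future-directed (`TimeOrientation.eq_of_isFutureUnitNormal`,
`CauchyDevelopmentOneJet`). This file proves that it is automatically **smooth along `ι`** as a
map `X → TM` (`DataEmbedding.contMDiffAt_embed_normal`, `DataEmbedding.mdifferentiableAt_embed_normal`),
discharging the differentiability hypothesis `hν` displayed by `CauchyDevelopmentRestrict`,
`MaximalCommonDevelopment` and the gluing files (`DevelopmentGluing`): O'Neill 1983, Ch. 4,
p. 99 and Lemma 4.19 ff. (a semi-Riemannian hypersurface has, locally, a smooth unit normal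
field; for a spacelike hypersurface of a time-oriented Lorentzian manifold the future unit normal
is the canonical global choice).

Proof (Gram–Schmidt against the orienting field, read in trivialisations). Fix `x₀` and read
everything through the tangent trivialisations at `x₀` and `ι x₀`: the metric `Ĝ(x)`
(`coordMetric`, smooth by `contMDiffAt_bilin_iff`), the differential `P(x) = dι_x`
(`coordDeriv` = Mathlib's `inTangentCoordinates`, smooth by `ContMDiffAt.mfderiv_const`) and the
orienting vector `T̂(x)` (`coordTime`). The Gram form `Q(x) = P(x)ᵀ Ĝ(x) P(x)` (`coordGram`) is
the data metric `h` read in the trivialisation, positive definite, so the operator `A(x)`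
(`coordOp`, `Q(x)` followed by the identification of functionals with vectors through the
standard basis, `dualToVec`) is invertible and `c(x) = A(x)⁻¹ (Ĝ(x)(T̂, P ·))` (`coordCoeff`,
smooth by `contDiffAt_map_inverse`) solves `Q(x)(c, w) = Ĝ(x)(T̂, P w)`. Then
`N(x) = T̂ - P c` (`coordNormal`) is `Ĝ`-normal to the image of `P`, timelike with
`Ĝ(N, N) = Ĝ(T̂, T̂) - Q(c, c) ≤ g(T, T) < 0` and `Ĝ(T̂, N) = Ĝ(N, N) < 0`; normalised and
transported back to `TM` it is a smooth future unit normal along `ι` near `x₀`, hence equal to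
`ν` there by uniqueness — so `ν` is smooth at `x₀`.

No named facts are introduced (D-0026); the auxiliary coordinate expressions are definitions
with bodies, everything else is proved.

## References

* B. O'Neill, *Semi-Riemannian geometry with applications to relativity*, Academic Press 1983,
  Ch. 4, p. 99 and Lemma 4.19 ff. (local unit normal fields of semi-Riemannian hypersurfaces),
  Ch. 5, Lemma 5.26 (the normal of a spacelike hyperplane is timelike).
* R. M. Wald, *General Relativity*, 1984, §10.2 (the unit normal `n^a` of a spacelike Cauchy
  surface).
-/

noncomputable section

open Bundle Set Function Filter Module
open scoped Manifold ContDiff Topology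

namespace Literature.Geometry.Lorentzian

universe u

/-! ### Functionals to vectors through the standard basis of `ℝᵐ` -/

section Dual

/-- The identification of a functional on `ℝᵐ` with the vector of its values on the standard
basis: `φ ↦ Σᵢ φ(eᵢ) eᵢ` (a continuous linear map; injective, `dualToVec_injective`). [folklore] -/
def dualToVec (m : ℕ) : (EuclideanSpace ℝ (Fin m) →L[ℝ] ℝ) →L[ℝ] EuclideanSpace ℝ (Fin m) :=
  ∑ i, (ContinuousLinearMap.apply ℝ ℝ (EuclideanSpace.single i (1 : ℝ))).smulRight
    (EuclideanSpace.single i (1 : ℝ))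

/-- `dualToVec φ = Σᵢ φ(eᵢ) eᵢ`. [folklore] -/
theorem dualToVec_apply {m : ℕ} (φ : EuclideanSpace ℝ (Fin m) →L[ℝ] ℝ) :
    dualToVec m φ = ∑ i, φ (EuclideanSpace.single i (1 : ℝ)) • EuclideanSpace.single i (1 : ℝ) := by
  simp [dualToVec]

/-- The `j`-th coordinate of `dualToVec φ` is `φ(eⱼ)`. [folklore] -/
theorem dualToVec_apply_coord {m : ℕ} (φ : EuclideanSpace ℝ (Fin m) →L[ℝ] ℝ) (j : Fin m) :
    dualToVec m φ j = φ (EuclideanSpace.single j (1 : ℝ)) := by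
  rw [dualToVec_apply]
  simp [Finset.sum_apply, Pi.single_apply]

/-- **`dualToVec` is injective**: a functional on `ℝᵐ` is determined by its values on the
standard basis. [folklore] -/
theorem dualToVec_injective (m : ℕ) : Injective (dualToVec m) := by
  intro φ ψ h
  have hcoord : ∀ j, φ (EuclideanSpace.single j (1 : ℝ)) = ψ (EuclideanSpace.single j (1 : ℝ)) :=
    fun j ↦ by rw [← dualToVec_apply_coord φ j, ← dualToVec_apply_coord ψ j, h]
  ext v
  have hv : v = ∑ j, v j • EuclideanSpace.single j (1 : ℝ) := by
    simpa using ((EuclideanSpace.basisFun (Fin m) ℝ).sum_repr v).symm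
  rw [hv, map_sum, map_sum]
  refine Finset.sum_congr rfl fun j _ ↦ ?_
  rw [map_smul, map_smul, hcoord j]

end Dual

/-! ### The data embedding read in trivialisations -/

section Developments

variable {n : ℕ} {X' : Type u} [TopologicalSpace X'] [ChartedSpace (EuclideanSpace ℝ (Fin n)) X']
  [IsManifold (𝓡 n) ∞ X'] [ConnectedSpace X'] {D : InitialDataSet (𝓡 n) X'}

namespace DataEmbedding

variable (𝒮 : DataEmbedding D) (x₀ : X')

/-- **The metric read in the tangent trivialisation at `ι x₀`, along `ι`**:
`Ĝ(x)(u, w) = g_{ι x}(τ⁻¹ u, τ⁻¹ w)`. [folklore] -/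
def coordMetric (x : X') :
    EuclideanSpace ℝ (Fin (n + 1)) →L[ℝ] EuclideanSpace ℝ (Fin (n + 1)) →L[ℝ] ℝ :=
  (ContinuousLinearMap.precomp ℝ ((trivializationAt (EuclideanSpace ℝ (Fin (n + 1))) (TangentSpace (𝓡 (n + 1)) : 𝒮.carrier → Type _) (𝒮.embed x₀)).symmL ℝ (𝒮.embed x))).comp
    ((𝒮.metric.val (𝒮.embed x)).comp ((trivializationAt (EuclideanSpace ℝ (Fin (n + 1))) (TangentSpace (𝓡 (n + 1)) : 𝒮.carrier → Type _) (𝒮.embed x₀)).symmL ℝ (𝒮.embed x)))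

/-- `Ĝ(x)(u, w) = g_{ι x}(τ⁻¹ u, τ⁻¹ w)`. [folklore] -/
theorem coordMetric_apply (x : X') (u w : EuclideanSpace ℝ (Fin (n + 1))) :
    𝒮.coordMetric x₀ x u w =
      𝒮.metric.val (𝒮.embed x) ((trivializationAt (EuclideanSpace ℝ (Fin (n + 1))) (TangentSpace (𝓡 (n + 1)) : 𝒮.carrier → Type _) (𝒮.embed x₀)).symmL ℝ (𝒮.embed x) u) ((trivializationAt (EuclideanSpace ℝ (Fin (n + 1))) (TangentSpace (𝓡 (n + 1)) : 𝒮.carrier → Type _) (𝒮.embed x₀)).symmL ℝ (𝒮.embed x) w) :=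
  rfl

/-- `Ĝ(x)` is symmetric. [folklore] -/
theorem coordMetric_symm (x : X') (u w : EuclideanSpace ℝ (Fin (n + 1))) :
    𝒮.coordMetric x₀ x u w = 𝒮.coordMetric x₀ x w u := by
  rw [coordMetric_apply, coordMetric_apply, 𝒮.metric.symm]

/-- **The differential of `ι` read in the tangent trivialisations at `x₀`, `ι x₀`** (Mathlib's
`inTangentCoordinates`): `P(x) = τ_M ∘ dι_x ∘ τ_X⁻¹`. [folklore] -/
def coordDeriv (x : X') : EuclideanSpace ℝ (Fin n) →L[ℝ] EuclideanSpace ℝ (Fin (n + 1)) :=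
  inTangentCoordinates (𝓡 n) (𝓡 (n + 1)) id 𝒮.embed
    (fun x ↦ mfderiv (𝓡 n) (𝓡 (n + 1)) 𝒮.embed x) x₀ x

/-- `P(x) u = τ_M (dι_x (τ_X⁻¹ u))`. [folklore] -/
theorem coordDeriv_apply (x : X') (u : EuclideanSpace ℝ (Fin n)) :
    𝒮.coordDeriv x₀ x u = (trivializationAt (EuclideanSpace ℝ (Fin (n + 1))) (TangentSpace (𝓡 (n + 1)) : 𝒮.carrier → Type _) (𝒮.embed x₀)).continuousLinearMapAt ℝ (𝒮.embed x)
      (mfderiv (𝓡 n) (𝓡 (n + 1)) 𝒮.embed x ((trivializationAt (EuclideanSpace ℝ (Fin n)) (TangentSpace (𝓡 n) : X' → Type _) x₀).symmL ℝ x u)) :=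
  rfl

/-- **The orienting vector read in the trivialisation**: `T̂(x) = τ_M (T (ι x))`. [folklore] -/
def coordTime (x : X') : EuclideanSpace ℝ (Fin (n + 1)) :=
  ((trivializationAt (EuclideanSpace ℝ (Fin (n + 1))) (TangentSpace (𝓡 (n + 1)) : 𝒮.carrier → Type _) (𝒮.embed x₀)) (⟨𝒮.embed x, 𝒮.timeOrientation.vectorField (𝒮.embed x)⟩ :
    TangentBundle (𝓡 (n + 1)) 𝒮.carrier)).2

/-- **The Gram form** `Q(x)(u, w) = Ĝ(x)(P u, P w)` (the data metric `h` read in the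
trivialisation of `TX`, `coordGram_apply_eq`). [folklore] -/
def coordGram (x : X') : EuclideanSpace ℝ (Fin n) →L[ℝ] EuclideanSpace ℝ (Fin n) →L[ℝ] ℝ :=
  (ContinuousLinearMap.precomp ℝ (𝒮.coordDeriv x₀ x)).comp
    ((𝒮.coordMetric x₀ x).comp (𝒮.coordDeriv x₀ x))

/-- `Q(x)(u, w) = Ĝ(x)(P u, P w)`. [folklore] -/
theorem coordGram_apply (x : X') (u w : EuclideanSpace ℝ (Fin n)) :
    𝒮.coordGram x₀ x u w = 𝒮.coordMetric x₀ x (𝒮.coordDeriv x₀ x u) (𝒮.coordDeriv x₀ x w) :=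
  rfl

/-- **The functional** `β(x)(w) = Ĝ(x)(T̂, P w)`. [folklore] -/
def coordFunctional (x : X') : EuclideanSpace ℝ (Fin n) →L[ℝ] ℝ :=
  (𝒮.coordMetric x₀ x (𝒮.coordTime x₀ x)).comp (𝒮.coordDeriv x₀ x)

/-- `β(x)(w) = Ĝ(x)(T̂, P w)`. [folklore] -/
theorem coordFunctional_apply (x : X') (w : EuclideanSpace ℝ (Fin n)) :
    𝒮.coordFunctional x₀ x w = 𝒮.coordMetric x₀ x (𝒮.coordTime x₀ x) (𝒮.coordDeriv x₀ x w) :=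
  rfl

/-- **The Gram operator** `A(x) = dualToVec ∘ Q(x) : ℝⁿ → ℝⁿ`. [folklore] -/
def coordOp (x : X') : EuclideanSpace ℝ (Fin n) →L[ℝ] EuclideanSpace ℝ (Fin n) :=
  (dualToVec n).comp (𝒮.coordGram x₀ x)

/-- **The tangential coefficients** `c(x) = A(x)⁻¹ (dualToVec β(x))`. [folklore] -/
def coordCoeff (x : X') : EuclideanSpace ℝ (Fin n) :=
  (𝒮.coordOp x₀ x).inverse (dualToVec n (𝒮.coordFunctional x₀ x))

/-- **The normal read in the trivialisation** `N(x) = T̂ - P c`. [folklore] -/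
def coordNormal (x : X') : EuclideanSpace ℝ (Fin (n + 1)) :=
  𝒮.coordTime x₀ x - 𝒮.coordDeriv x₀ x (𝒮.coordCoeff x₀ x)

/-- **The unit normal read in the trivialisation** `ν̂(x) = N / √(-Ĝ(N, N))`. [folklore] -/
def coordUnitNormal (x : X') : EuclideanSpace ℝ (Fin (n + 1)) :=
  (Real.sqrt (-(𝒮.coordMetric x₀ x (𝒮.coordNormal x₀ x) (𝒮.coordNormal x₀ x))))⁻¹ •
    𝒮.coordNormal x₀ x

/-- **The smooth unit normal** `ν̃(x) = τ_M⁻¹ ν̂(x) ∈ T_{ι x} M`. [folklore] -/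
def smoothNormal (x : X') : TangentSpace (𝓡 (n + 1)) (𝒮.embed x) :=
  (trivializationAt (EuclideanSpace ℝ (Fin (n + 1))) (TangentSpace (𝓡 (n + 1)) : 𝒮.carrier → Type _) (𝒮.embed x₀)).symmL ℝ (𝒮.embed x) (𝒮.coordUnitNormal x₀ x)

/-! ### Smoothness of the coordinate expressions at `x₀` -/

/-- `ι` is `C^∞`. [folklore] -/
theorem contMDiff_embed : ContMDiff (𝓡 n) (𝓡 (n + 1)) ∞ 𝒮.embed :=
  𝒮.isSmoothEmbedding.contMDiff

/-- **`Ĝ` is smooth at `x₀`** (the metric is a smooth section of the bundle of bilinear forms;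
`contMDiffAt_bilin_iff` along the base map `ι`). [folklore] -/
theorem contMDiffAt_coordMetric :
    ContMDiffAt (𝓡 n) 𝓘(ℝ, EuclideanSpace ℝ (Fin (n + 1)) →L[ℝ] EuclideanSpace ℝ (Fin (n + 1)) →L[ℝ] ℝ)
      ∞ (𝒮.coordMetric x₀) x₀ := by
  have h : ContMDiffAt (𝓡 n) ((𝓡 (n + 1)).prod 𝓘(ℝ, EuclideanSpace ℝ (Fin (n + 1)) →L[ℝ]
      EuclideanSpace ℝ (Fin (n + 1)) →L[ℝ] ℝ)) ∞ (fun x ↦ TotalSpace.mk'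
        (EuclideanSpace ℝ (Fin (n + 1)) →L[ℝ] EuclideanSpace ℝ (Fin (n + 1)) →L[ℝ] ℝ)
        (E := fun b : 𝒮.carrier ↦ TangentSpace (𝓡 (n + 1)) b →L[ℝ]
          TangentSpace (𝓡 (n + 1)) b →L[ℝ] ℝ) (𝒮.embed x) (𝒮.metric.val (𝒮.embed x))) x₀ :=
    (𝒮.metric.contMDiff (𝒮.embed x₀)).comp x₀ (𝒮.contMDiff_embed x₀)
  exact ((contMDiffAt_bilin_iff (IX := 𝓡 n) (IB := 𝓡 (n + 1))
    (V := (TangentSpace (𝓡 (n + 1)) : 𝒮.carrier → Type _)) (b := 𝒮.embed)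
    (s := fun x ↦ 𝒮.metric.val (𝒮.embed x)) (x₀ := x₀)).1 h).2

/-- **`P` is smooth at `x₀`** (`ContMDiffAt.mfderiv_const`). [folklore] -/
theorem contMDiffAt_coordDeriv :
    ContMDiffAt (𝓡 n) 𝓘(ℝ, EuclideanSpace ℝ (Fin n) →L[ℝ] EuclideanSpace ℝ (Fin (n + 1))) ∞
      (𝒮.coordDeriv x₀) x₀ :=
  ContMDiffAt.mfderiv_const (𝒮.contMDiff_embed x₀) le_rfl

/-- **`T̂` is smooth at `x₀`** (the fibre coordinate of the smooth map `x ↦ T(ι x)` into `TM`).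
[folklore] -/
theorem contMDiffAt_coordTime :
    ContMDiffAt (𝓡 n) 𝓘(ℝ, EuclideanSpace ℝ (Fin (n + 1))) ∞ (𝒮.coordTime x₀) x₀ := by
  have h : ContMDiffAt (𝓡 n) (𝓡 (n + 1)).tangent ∞ (fun x ↦ (⟨𝒮.embed x,
      𝒮.timeOrientation.vectorField (𝒮.embed x)⟩ : TangentBundle (𝓡 (n + 1)) 𝒮.carrier)) x₀ :=
    (𝒮.timeOrientation.contMDiff (𝒮.embed x₀)).comp x₀ (𝒮.contMDiff_embed x₀)
  exact (contMDiffAt_totalSpace.1 h).2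

/-- `Q` is smooth at `x₀`. [folklore] -/
theorem contMDiffAt_coordGram :
    ContMDiffAt (𝓡 n) 𝓘(ℝ, EuclideanSpace ℝ (Fin n) →L[ℝ] EuclideanSpace ℝ (Fin n) →L[ℝ] ℝ) ∞
      (𝒮.coordGram x₀) x₀ :=
  ((𝒮.contMDiffAt_coordDeriv x₀).clm_precomp (F₃ := ℝ)).clm_comp
    ((𝒮.contMDiffAt_coordMetric x₀).clm_comp (𝒮.contMDiffAt_coordDeriv x₀))

/-- `β` is smooth at `x₀`. [folklore] -/
theorem contMDiffAt_coordFunctional :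
    ContMDiffAt (𝓡 n) 𝓘(ℝ, EuclideanSpace ℝ (Fin n) →L[ℝ] ℝ) ∞ (𝒮.coordFunctional x₀) x₀ :=
  ((𝒮.contMDiffAt_coordMetric x₀).clm_apply (𝒮.contMDiffAt_coordTime x₀)).clm_comp
    (𝒮.contMDiffAt_coordDeriv x₀)

/-- `A` is smooth at `x₀`. [folklore] -/
theorem contMDiffAt_coordOp :
    ContMDiffAt (𝓡 n) 𝓘(ℝ, EuclideanSpace ℝ (Fin n) →L[ℝ] EuclideanSpace ℝ (Fin n)) ∞
      (𝒮.coordOp x₀) x₀ :=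
  contMDiffAt_const.clm_comp (𝒮.contMDiffAt_coordGram x₀)


/-! ### Pointwise algebra at the points of the two chart domains -/

variable {x₀}

/-- Base-set membership for the trivialisation of `TM` at `ι x₀`. [folklore] -/
theorem mem_baseSet_of_mem {x : X'}
    (hxM : 𝒮.embed x ∈ (chartAt (EuclideanSpace ℝ (Fin (n + 1))) (𝒮.embed x₀)).source) :
    𝒮.embed x ∈ (trivializationAt (EuclideanSpace ℝ (Fin (n + 1))) (TangentSpace (𝓡 (n + 1)) : 𝒮.carrier → Type _) (𝒮.embed x₀)).baseSet := by
  rw [TangentBundle.trivializationAt_baseSet]; exact hxM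

omit [ConnectedSpace X'] in
/-- Base-set membership for the trivialisation of `TX` at `x₀`. [folklore] -/
theorem mem_baseSet_of_mem' {x : X'} (hxX : x ∈ (chartAt (EuclideanSpace ℝ (Fin n)) x₀).source) :
    x ∈ (trivializationAt (EuclideanSpace ℝ (Fin n)) (TangentSpace (𝓡 n) : X' → Type _) x₀).baseSet := by
  rw [TangentBundle.trivializationAt_baseSet]; exact hxX

/-- `τ_M⁻¹ T̂(x) = T(ι x)`. [folklore] -/
theorem symmL_coordTime {x : X'}
    (hxM : 𝒮.embed x ∈ (chartAt (EuclideanSpace ℝ (Fin (n + 1))) (𝒮.embed x₀)).source) :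
    (trivializationAt (EuclideanSpace ℝ (Fin (n + 1))) (TangentSpace (𝓡 (n + 1)) : 𝒮.carrier → Type _) (𝒮.embed x₀)).symmL ℝ (𝒮.embed x) (𝒮.coordTime x₀ x) = 𝒮.timeOrientation.vectorField (𝒮.embed x) := by
  have hb := 𝒮.mem_baseSet_of_mem hxM
  rw [coordTime, ← Trivialization.continuousLinearMapAt_apply_of_mem (R := ℝ) (hb := hb),
    Trivialization.symmL_continuousLinearMapAt _ hb]

/-- `τ_M⁻¹ (P(x) u) = dι_x (τ_X⁻¹ u)`. [folklore] -/
theorem symmL_coordDeriv {x : X'}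
    (hxM : 𝒮.embed x ∈ (chartAt (EuclideanSpace ℝ (Fin (n + 1))) (𝒮.embed x₀)).source)
    (u : EuclideanSpace ℝ (Fin n)) :
    (trivializationAt (EuclideanSpace ℝ (Fin (n + 1))) (TangentSpace (𝓡 (n + 1)) : 𝒮.carrier → Type _) (𝒮.embed x₀)).symmL ℝ (𝒮.embed x) (𝒮.coordDeriv x₀ x u) =
      mfderiv (𝓡 n) (𝓡 (n + 1)) 𝒮.embed x ((trivializationAt (EuclideanSpace ℝ (Fin n)) (TangentSpace (𝓡 n) : X' → Type _) x₀).symmL ℝ x u) := by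
  rw [coordDeriv_apply, Trivialization.symmL_continuousLinearMapAt _ (𝒮.mem_baseSet_of_mem hxM)]

/-- **The Gram form is the data metric read in the trivialisation of `TX`**:
`Q(x)(u, w) = h_x(τ_X⁻¹ u, τ_X⁻¹ w)`. [folklore] -/
theorem coordGram_apply_eq {x : X'}
    (hxM : 𝒮.embed x ∈ (chartAt (EuclideanSpace ℝ (Fin (n + 1))) (𝒮.embed x₀)).source)
    (u w : EuclideanSpace ℝ (Fin n)) :
    𝒮.coordGram x₀ x u w = D.h.inner x ((trivializationAt (EuclideanSpace ℝ (Fin n)) (TangentSpace (𝓡 n) : X' → Type _) x₀).symmL ℝ x u) ((trivializationAt (EuclideanSpace ℝ (Fin n)) (TangentSpace (𝓡 n) : X' → Type _) x₀).symmL ℝ x w) := by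
  rw [coordGram_apply, coordMetric_apply, 𝒮.symmL_coordDeriv hxM, 𝒮.symmL_coordDeriv hxM,
    val_mfderiv_embed]

/-- `Q(x)(u, u) ≥ 0`. [folklore] -/
theorem coordGram_nonneg {x : X'}
    (hxM : 𝒮.embed x ∈ (chartAt (EuclideanSpace ℝ (Fin (n + 1))) (𝒮.embed x₀)).source)
    (u : EuclideanSpace ℝ (Fin n)) : 0 ≤ 𝒮.coordGram x₀ x u u := by
  rw [𝒮.coordGram_apply_eq hxM]
  by_cases hu : (trivializationAt (EuclideanSpace ℝ (Fin n)) (TangentSpace (𝓡 n) : X' → Type _) x₀).symmL ℝ x u = 0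
  · simp [hu]
  · exact (D.h.pos x _ hu).le

/-- `Q(x)(u, u) = 0` forces `u = 0` (positivity of `h`, injectivity of `τ_X⁻¹`). [folklore] -/
theorem eq_zero_of_coordGram_self_eq_zero {x : X'}
    (hxX : x ∈ (chartAt (EuclideanSpace ℝ (Fin n)) x₀).source)
    (hxM : 𝒮.embed x ∈ (chartAt (EuclideanSpace ℝ (Fin (n + 1))) (𝒮.embed x₀)).source)
    {u : EuclideanSpace ℝ (Fin n)} (hu : 𝒮.coordGram x₀ x u u = 0) : u = 0 := by
  rw [𝒮.coordGram_apply_eq hxM] at hu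
  have h0 : (trivializationAt (EuclideanSpace ℝ (Fin n)) (TangentSpace (𝓡 n) : X' → Type _) x₀).symmL ℝ x u = 0 := by
    by_contra hne
    exact (D.h.pos x _ hne).ne' hu
  have h := congrArg ((trivializationAt (EuclideanSpace ℝ (Fin n)) (TangentSpace (𝓡 n) : X' → Type _) x₀).continuousLinearMapAt ℝ x) h0
  rwa [Trivialization.continuousLinearMapAt_symmL _ (mem_baseSet_of_mem' hxX), map_zero] at h

/-- **The Gram operator is invertible** at the points of the two chart domains. [folklore] -/
theorem isInvertible_coordOp {x : X'}
    (hxX : x ∈ (chartAt (EuclideanSpace ℝ (Fin n)) x₀).source)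
    (hxM : 𝒮.embed x ∈ (chartAt (EuclideanSpace ℝ (Fin (n + 1))) (𝒮.embed x₀)).source) :
    (𝒮.coordOp x₀ x).IsInvertible := by
  have hinj : Injective (𝒮.coordOp x₀ x) := by
    refine (injective_iff_map_eq_zero _).2 fun u hu ↦ ?_
    have h1 : dualToVec n (𝒮.coordGram x₀ x u) = dualToVec n 0 := by
      rw [map_zero]; exact hu
    have h2 : 𝒮.coordGram x₀ x u = 0 := dualToVec_injective n h1
    exact 𝒮.eq_zero_of_coordGram_self_eq_zero hxX hxM (by rw [h2]; rfl)
  refine JetRigidity.isInvertible_of_bijective ⟨hinj, ?_⟩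
  exact (LinearMap.injective_iff_surjective_of_finrank_eq_finrank
    (f := (𝒮.coordOp x₀ x : EuclideanSpace ℝ (Fin n) →ₗ[ℝ] EuclideanSpace ℝ (Fin n))) rfl).1 hinj

/-- **The defining equation of the tangential coefficients**: `Q(x)(c, w) = Ĝ(x)(T̂, P w)`.
[folklore] -/
theorem coordGram_coordCoeff {x : X'}
    (hxX : x ∈ (chartAt (EuclideanSpace ℝ (Fin n)) x₀).source)
    (hxM : 𝒮.embed x ∈ (chartAt (EuclideanSpace ℝ (Fin (n + 1))) (𝒮.embed x₀)).source)
    (w : EuclideanSpace ℝ (Fin n)) :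
    𝒮.coordGram x₀ x (𝒮.coordCoeff x₀ x) w = 𝒮.coordFunctional x₀ x w := by
  obtain ⟨e, he⟩ := 𝒮.isInvertible_coordOp hxX hxM
  have h1 : 𝒮.coordOp x₀ x (𝒮.coordCoeff x₀ x) = dualToVec n (𝒮.coordFunctional x₀ x) := by
    rw [coordCoeff, ← he, ContinuousLinearMap.inverse_equiv]
    exact e.apply_symm_apply _
  have h2 : 𝒮.coordGram x₀ x (𝒮.coordCoeff x₀ x) = 𝒮.coordFunctional x₀ x :=
    dualToVec_injective n h1
  rw [h2]

/-- **`N` is normal**: `Ĝ(x)(N, P w) = 0`. [folklore] -/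
theorem coordMetric_coordNormal_coordDeriv {x : X'}
    (hxX : x ∈ (chartAt (EuclideanSpace ℝ (Fin n)) x₀).source)
    (hxM : 𝒮.embed x ∈ (chartAt (EuclideanSpace ℝ (Fin (n + 1))) (𝒮.embed x₀)).source)
    (w : EuclideanSpace ℝ (Fin n)) :
    𝒮.coordMetric x₀ x (𝒮.coordNormal x₀ x) (𝒮.coordDeriv x₀ x w) = 0 := by
  have e1 : 𝒮.coordMetric x₀ x (𝒮.coordNormal x₀ x) (𝒮.coordDeriv x₀ x w) =
      𝒮.coordMetric x₀ x (𝒮.coordTime x₀ x) (𝒮.coordDeriv x₀ x w) -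
        𝒮.coordMetric x₀ x (𝒮.coordDeriv x₀ x (𝒮.coordCoeff x₀ x)) (𝒮.coordDeriv x₀ x w) := by
    simp only [coordNormal, map_sub, FunLike.coe_sub, Pi.sub_apply]
  rw [e1, ← coordFunctional_apply, ← coordGram_apply, 𝒮.coordGram_coordCoeff hxX hxM, sub_self]

/-- `Ĝ(x)(N, N) = Ĝ(x)(T̂, T̂) - Q(x)(c, c)`. [folklore] -/
theorem coordMetric_coordNormal_self {x : X'}
    (hxX : x ∈ (chartAt (EuclideanSpace ℝ (Fin n)) x₀).source)
    (hxM : 𝒮.embed x ∈ (chartAt (EuclideanSpace ℝ (Fin (n + 1))) (𝒮.embed x₀)).source) :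
    𝒮.coordMetric x₀ x (𝒮.coordNormal x₀ x) (𝒮.coordNormal x₀ x) =
      𝒮.coordMetric x₀ x (𝒮.coordTime x₀ x) (𝒮.coordTime x₀ x) -
        𝒮.coordGram x₀ x (𝒮.coordCoeff x₀ x) (𝒮.coordCoeff x₀ x) := by
  have h1 : 𝒮.coordMetric x₀ x (𝒮.coordTime x₀ x) (𝒮.coordDeriv x₀ x (𝒮.coordCoeff x₀ x)) =
      𝒮.coordGram x₀ x (𝒮.coordCoeff x₀ x) (𝒮.coordCoeff x₀ x) := by
    rw [← coordFunctional_apply, 𝒮.coordGram_coordCoeff hxX hxM]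
  have h2 : 𝒮.coordMetric x₀ x (𝒮.coordDeriv x₀ x (𝒮.coordCoeff x₀ x)) (𝒮.coordTime x₀ x) =
      𝒮.coordGram x₀ x (𝒮.coordCoeff x₀ x) (𝒮.coordCoeff x₀ x) := by
    rw [coordMetric_symm, h1]
  have h3 : 𝒮.coordMetric x₀ x (𝒮.coordDeriv x₀ x (𝒮.coordCoeff x₀ x))
      (𝒮.coordDeriv x₀ x (𝒮.coordCoeff x₀ x)) =
      𝒮.coordGram x₀ x (𝒮.coordCoeff x₀ x) (𝒮.coordCoeff x₀ x) := rfl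
  have e1 : 𝒮.coordMetric x₀ x (𝒮.coordNormal x₀ x) (𝒮.coordNormal x₀ x) =
      𝒮.coordMetric x₀ x (𝒮.coordTime x₀ x) (𝒮.coordTime x₀ x) -
        𝒮.coordMetric x₀ x (𝒮.coordTime x₀ x) (𝒮.coordDeriv x₀ x (𝒮.coordCoeff x₀ x)) -
        (𝒮.coordMetric x₀ x (𝒮.coordDeriv x₀ x (𝒮.coordCoeff x₀ x)) (𝒮.coordTime x₀ x) -
          𝒮.coordMetric x₀ x (𝒮.coordDeriv x₀ x (𝒮.coordCoeff x₀ x))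
            (𝒮.coordDeriv x₀ x (𝒮.coordCoeff x₀ x))) := by
    simp only [coordNormal, map_sub, FunLike.coe_sub, Pi.sub_apply]
    ring
  rw [e1, h1, h2, h3]
  ring

/-- `Ĝ(x)(T̂, T̂) = g(T, T) < 0`. [folklore] -/
theorem coordMetric_coordTime_self_neg {x : X'}
    (hxM : 𝒮.embed x ∈ (chartAt (EuclideanSpace ℝ (Fin (n + 1))) (𝒮.embed x₀)).source) :
    𝒮.coordMetric x₀ x (𝒮.coordTime x₀ x) (𝒮.coordTime x₀ x) < 0 := by
  rw [coordMetric_apply, 𝒮.symmL_coordTime hxM]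
  exact 𝒮.timeOrientation.isTimelike (𝒮.embed x)

/-- **`N` is timelike**: `Ĝ(x)(N, N) < 0`. [cite: ONeillSemiRiemannian1983, Ch. 5, Lemma 5.26] -/
theorem coordMetric_coordNormal_self_neg {x : X'}
    (hxX : x ∈ (chartAt (EuclideanSpace ℝ (Fin n)) x₀).source)
    (hxM : 𝒮.embed x ∈ (chartAt (EuclideanSpace ℝ (Fin (n + 1))) (𝒮.embed x₀)).source) :
    𝒮.coordMetric x₀ x (𝒮.coordNormal x₀ x) (𝒮.coordNormal x₀ x) < 0 := by
  rw [𝒮.coordMetric_coordNormal_self hxX hxM]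
  linarith [𝒮.coordMetric_coordTime_self_neg hxM, 𝒮.coordGram_nonneg hxM (𝒮.coordCoeff x₀ x)]

/-- `Ĝ(x)(T̂, N) = Ĝ(x)(N, N)`. [folklore] -/
theorem coordMetric_coordTime_coordNormal {x : X'}
    (hxX : x ∈ (chartAt (EuclideanSpace ℝ (Fin n)) x₀).source)
    (hxM : 𝒮.embed x ∈ (chartAt (EuclideanSpace ℝ (Fin (n + 1))) (𝒮.embed x₀)).source) :
    𝒮.coordMetric x₀ x (𝒮.coordTime x₀ x) (𝒮.coordNormal x₀ x) =
      𝒮.coordMetric x₀ x (𝒮.coordNormal x₀ x) (𝒮.coordNormal x₀ x) := by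
  rw [𝒮.coordMetric_coordNormal_self hxX hxM]
  rw [coordNormal, map_sub, ← coordFunctional_apply, 𝒮.coordGram_coordCoeff hxX hxM]

/-- **The unit normal read in the trivialisation is a future unit normal**: `Ĝ(ν̂, P w) = 0`,
`Ĝ(ν̂, ν̂) = -1`, `Ĝ(T̂, ν̂) < 0`. [cite: ONeillSemiRiemannian1983, Ch. 4, Lemma 4.19 ff.] -/
theorem coordUnitNormal_spec {x : X'}
    (hxX : x ∈ (chartAt (EuclideanSpace ℝ (Fin n)) x₀).source)
    (hxM : 𝒮.embed x ∈ (chartAt (EuclideanSpace ℝ (Fin (n + 1))) (𝒮.embed x₀)).source) :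
    (∀ w, 𝒮.coordMetric x₀ x (𝒮.coordUnitNormal x₀ x) (𝒮.coordDeriv x₀ x w) = 0) ∧
      𝒮.coordMetric x₀ x (𝒮.coordUnitNormal x₀ x) (𝒮.coordUnitNormal x₀ x) = -1 ∧
      𝒮.coordMetric x₀ x (𝒮.coordTime x₀ x) (𝒮.coordUnitNormal x₀ x) < 0 := by
  set a := 𝒮.coordMetric x₀ x (𝒮.coordNormal x₀ x) (𝒮.coordNormal x₀ x) with ha
  have haneg : a < 0 := 𝒮.coordMetric_coordNormal_self_neg hxX hxM
  set r := Real.sqrt (-a) with hr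
  have hrpos : 0 < r := Real.sqrt_pos.2 (by linarith)
  have hrsq : r * r = -a := Real.mul_self_sqrt (by linarith)
  have hunit : 𝒮.coordUnitNormal x₀ x = r⁻¹ • 𝒮.coordNormal x₀ x := rfl
  have hr0 : r ≠ 0 := hrpos.ne'
  refine ⟨fun w ↦ ?_, ?_, ?_⟩
  · simp only [hunit, map_smul, FunLike.coe_smul, Pi.smul_apply, smul_eq_mul,
      𝒮.coordMetric_coordNormal_coordDeriv hxX hxM, mul_zero]
  · simp only [hunit, map_smul, FunLike.coe_smul, Pi.smul_apply, smul_eq_mul]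
    rw [← ha]
    field_simp
    linarith
  · simp only [hunit, map_smul, smul_eq_mul]
    rw [𝒮.coordMetric_coordTime_coordNormal hxX hxM, ← ha]
    exact mul_neg_of_pos_of_neg (inv_pos.2 hrpos) haneg

/-- **The transported unit normal `ν̃(x) = τ_M⁻¹ ν̂(x)` is the future unit normal `ν(x)`** at
the points of the two chart domains (uniqueness of the future unit normal,
`TimeOrientation.eq_of_isFutureUnitNormal`). [cite: ONeillSemiRiemannian1983, Ch. 4, Lemma 4.19 ff. and Ch. 5, Lemma 5.26] -/
theorem smoothNormal_eq_normal {x : X'}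
    (hxX : x ∈ (chartAt (EuclideanSpace ℝ (Fin n)) x₀).source)
    (hxM : 𝒮.embed x ∈ (chartAt (EuclideanSpace ℝ (Fin (n + 1))) (𝒮.embed x₀)).source) :
    𝒮.smoothNormal x₀ x = 𝒮.normal x := by
  obtain ⟨hN, hunit, hfut⟩ := 𝒮.coordUnitNormal_spec hxX hxM
  have hbM := 𝒮.mem_baseSet_of_mem hxM
  have hbX := mem_baseSet_of_mem' (x₀ := x₀) hxX
  -- the three properties of `ν̃` in `T_{ι x} M`
  have huJ : ∀ v : TangentSpace (𝓡 n) x, 𝒮.metric.val (𝒮.embed x) (𝒮.smoothNormal x₀ x)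
      (mfderiv (𝓡 n) (𝓡 (n + 1)) 𝒮.embed x v) = 0 := fun v ↦ by
    have hv : v = (trivializationAt (EuclideanSpace ℝ (Fin n)) (TangentSpace (𝓡 n) : X' → Type _) x₀).symmL ℝ x ((trivializationAt (EuclideanSpace ℝ (Fin n)) (TangentSpace (𝓡 n) : X' → Type _) x₀).continuousLinearMapAt ℝ x v) :=
      (Trivialization.symmL_continuousLinearMapAt _ hbX v).symm
    rw [hv, ← 𝒮.symmL_coordDeriv hxM, smoothNormal, ← coordMetric_apply]
    exact hN _
  have huu : 𝒮.metric.val (𝒮.embed x) (𝒮.smoothNormal x₀ x) (𝒮.smoothNormal x₀ x) = -1 := by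
    rw [smoothNormal, ← coordMetric_apply]
    exact hunit
  have hu : 𝒮.timeOrientation.IsFutureDirected (𝒮.smoothNormal x₀ x) := by
    have ht : 𝒮.metric.val (𝒮.embed x) (𝒮.timeOrientation.vectorField (𝒮.embed x))
        (𝒮.smoothNormal x₀ x) < 0 := by
      rw [← 𝒮.symmL_coordTime hxM, smoothNormal, ← coordMetric_apply]
      exact hfut
    refine ⟨⟨?_, fun h0 ↦ ?_⟩, ht⟩
    · exact le_of_lt (huu.trans_lt (by norm_num))
    · rw [h0, map_zero] at ht
      exact lt_irrefl _ ht
  exact 𝒮.timeOrientation.eq_of_isFutureUnitNormal rfl (mfderiv (𝓡 n) (𝓡 (n + 1)) 𝒮.embed x)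
    (fun v hv ↦ 𝒮.val_mfderiv_embed_pos x hv) (finrank_tangentSpace_add_one x)
    (𝒮.isFutureUnitNormal.1.1 x) (𝒮.isFutureUnitNormal.1.2 x) (𝒮.isFutureUnitNormal.2 x)
    huJ huu hu

/-! ### Smoothness of the coefficients and of the unit normal; assembly -/

variable (x₀)

/-- `c` is smooth at `x₀` (`contDiffAt_map_inverse` at the invertible `A(x₀)`). [folklore] -/
theorem contMDiffAt_coordCoeff :
    ContMDiffAt (𝓡 n) 𝓘(ℝ, EuclideanSpace ℝ (Fin n)) ∞ (𝒮.coordCoeff x₀) x₀ := by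
  obtain ⟨e, he⟩ := 𝒮.isInvertible_coordOp (x₀ := x₀) (mem_chart_source _ x₀)
    (mem_chart_source _ (𝒮.embed x₀))
  have h1 : ContDiffAt ℝ ∞ ContinuousLinearMap.inverse (𝒮.coordOp x₀ x₀) := by
    rw [← he]
    exact contDiffAt_map_inverse e
  have h2 : ContMDiffAt (𝓡 n) 𝓘(ℝ, EuclideanSpace ℝ (Fin n) →L[ℝ] EuclideanSpace ℝ (Fin n)) ∞
      (fun x ↦ (𝒮.coordOp x₀ x).inverse) x₀ := h1.comp_contMDiffAt (𝒮.contMDiffAt_coordOp x₀)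
  have h3 : ContMDiffAt (𝓡 n) 𝓘(ℝ, EuclideanSpace ℝ (Fin n)) ∞
      (fun x ↦ dualToVec n (𝒮.coordFunctional x₀ x)) x₀ :=
    contMDiffAt_const.clm_apply (𝒮.contMDiffAt_coordFunctional x₀)
  exact h2.clm_apply h3

/-- `N` is smooth at `x₀`. [folklore] -/
theorem contMDiffAt_coordNormal :
    ContMDiffAt (𝓡 n) 𝓘(ℝ, EuclideanSpace ℝ (Fin (n + 1))) ∞ (𝒮.coordNormal x₀) x₀ :=
  (𝒮.contMDiffAt_coordTime x₀).sub ((𝒮.contMDiffAt_coordDeriv x₀).clm_apply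
    (𝒮.contMDiffAt_coordCoeff x₀))

/-- `ν̂` is smooth at `x₀` (`Ĝ(N, N) < 0` at `x₀`). [folklore] -/
theorem contMDiffAt_coordUnitNormal :
    ContMDiffAt (𝓡 n) 𝓘(ℝ, EuclideanSpace ℝ (Fin (n + 1))) ∞ (𝒮.coordUnitNormal x₀) x₀ := by
  set ρ : X' → ℝ := fun x ↦ -(𝒮.coordMetric x₀ x (𝒮.coordNormal x₀ x) (𝒮.coordNormal x₀ x))
    with hρdef
  have hρ : ContMDiffAt (𝓡 n) 𝓘(ℝ, ℝ) ∞ ρ x₀ :=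
    (((𝒮.contMDiffAt_coordMetric x₀).clm_apply (𝒮.contMDiffAt_coordNormal x₀)).clm_apply
      (𝒮.contMDiffAt_coordNormal x₀)).neg
  have hpos : 0 < ρ x₀ := by
    have h := 𝒮.coordMetric_coordNormal_self_neg (x₀ := x₀) (mem_chart_source _ x₀)
      (mem_chart_source _ (𝒮.embed x₀))
    simp only [hρdef]
    linarith
  set σ : X' → ℝ := fun x ↦ Real.sqrt (ρ x) with hσdef
  have hsqrt : ContMDiffAt (𝓡 n) 𝓘(ℝ, ℝ) ∞ σ x₀ :=
    (Real.contDiffAt_sqrt (x := ρ x₀) hpos.ne').comp_contMDiffAt hρ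
  have hσpos : σ x₀ ≠ 0 := (Real.sqrt_pos.2 hpos).ne'
  have hinv : ContMDiffAt (𝓡 n) 𝓘(ℝ, ℝ) ∞ (fun x ↦ (σ x)⁻¹) x₀ :=
    (contDiffAt_inv ℝ hσpos).comp_contMDiffAt hsqrt
  exact hinv.smul (𝒮.contMDiffAt_coordNormal x₀)

/-- **The future unit normal of a data embedding is smooth along the data embedding**: the
map `x ↦ (ι x, ν x) : X → TM` is `C^∞` (O'Neill 1983, Ch. 4, p. 99 and Lemma 4.19 ff.: local
unit normal fields of hypersurfaces are smooth; here the future unit normal is unique, so it is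
the smooth transported field `ν̃` near every point, `smoothNormal_eq_normal`). This discharges
the hypothesis `hν` of `CauchyDevelopmentRestrict`, `MaximalCommonDevelopment` and the gluing
construction (`DevelopmentGluing`). [cite: ONeillSemiRiemannian1983, Ch. 4, p. 99 and Lemma 4.19 ff.] -/
theorem contMDiffAt_embed_normal :
    ContMDiffAt (𝓡 n) (𝓡 (n + 1)).tangent ∞
      (fun x ↦ (TotalSpace.mk' (EuclideanSpace ℝ (Fin (n + 1))) (𝒮.embed x) (𝒮.normal x) :
        TangentBundle (𝓡 (n + 1)) 𝒮.carrier)) x₀ := by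
  have hg1 : ∀ᶠ x in 𝓝 x₀, x ∈ (chartAt (EuclideanSpace ℝ (Fin n)) x₀).source :=
    (chartAt _ x₀).open_source.mem_nhds (mem_chart_source _ x₀)
  have hg2 : ∀ᶠ x in 𝓝 x₀,
      𝒮.embed x ∈ (chartAt (EuclideanSpace ℝ (Fin (n + 1))) (𝒮.embed x₀)).source :=
    (𝒮.contMDiff_embed x₀).continuousAt.preimage_mem_nhds
      ((chartAt _ (𝒮.embed x₀)).open_source.mem_nhds (mem_chart_source _ (𝒮.embed x₀)))
  have hgood := hg1.and hg2
  -- the transported unit normal is smooth at `x₀`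
  have key : ContMDiffAt (𝓡 n) (𝓡 (n + 1)).tangent ∞
      (fun x ↦ (TotalSpace.mk' (EuclideanSpace ℝ (Fin (n + 1))) (𝒮.embed x) (𝒮.smoothNormal x₀ x) :
        TangentBundle (𝓡 (n + 1)) 𝒮.carrier)) x₀ := by
    rw [contMDiffAt_totalSpace]
    refine ⟨𝒮.contMDiff_embed x₀, ?_⟩
    refine (𝒮.contMDiffAt_coordUnitNormal x₀).congr_of_eventuallyEq ?_
    filter_upwards [hgood] with x hx
    have hb := 𝒮.mem_baseSet_of_mem hx.2
    show ((trivializationAt (EuclideanSpace ℝ (Fin (n + 1))) (TangentSpace (𝓡 (n + 1)) : 𝒮.carrier → Type _) (𝒮.embed x₀)) (⟨𝒮.embed x, (trivializationAt (EuclideanSpace ℝ (Fin (n + 1))) (TangentSpace (𝓡 (n + 1)) : 𝒮.carrier → Type _) (𝒮.embed x₀)).symmL ℝ (𝒮.embed x) (𝒮.coordUnitNormal x₀ x)⟩ :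
      TangentBundle (𝓡 (n + 1)) 𝒮.carrier)).2 = 𝒮.coordUnitNormal x₀ x
    rw [Trivialization.symmL_apply _ hb]
    have h := Trivialization.apply_mk_symm (trivializationAt (EuclideanSpace ℝ (Fin (n + 1))) (TangentSpace (𝓡 (n + 1)) : 𝒮.carrier → Type _) (𝒮.embed x₀)) hb (𝒮.coordUnitNormal x₀ x)
    exact (congrArg Prod.snd h).trans rfl
  refine key.congr_of_eventuallyEq ?_
  filter_upwards [hgood] with x hx
  show (TotalSpace.mk' (EuclideanSpace ℝ (Fin (n + 1))) (𝒮.embed x) (𝒮.normal x) :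
      TangentBundle (𝓡 (n + 1)) 𝒮.carrier) =
    TotalSpace.mk' (EuclideanSpace ℝ (Fin (n + 1))) (𝒮.embed x) (𝒮.smoothNormal x₀ x)
  rw [𝒮.smoothNormal_eq_normal hx.1 hx.2]

/-- **The future unit normal of a data embedding is differentiable along the data embedding**
(the form of the hypothesis `hν` of `CauchyDevelopmentRestrict` and `DevelopmentGluing`).
[cite: ONeillSemiRiemannian1983, Ch. 4, p. 99 and Lemma 4.19 ff.] -/
theorem mdifferentiableAt_embed_normal (x : X') :
    MDifferentiableAt (𝓡 n) (𝓡 (n + 1)).tangent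
      (fun x ↦ (TotalSpace.mk' (EuclideanSpace ℝ (Fin (n + 1))) (𝒮.embed x) (𝒮.normal x) :
        TangentBundle (𝓡 (n + 1)) 𝒮.carrier)) x :=
  (𝒮.contMDiffAt_embed_normal x).mdifferentiableAt (by simp)

end DataEmbedding

end Developments

end Literature.Geometry.Lorentzian

end
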